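import Summits.HodgeConjecture.HodgeConjecture.Theorems.NodalThetaWeilNodeDualClassesAlgebraicNodalBoundary
import Summits.HodgeConjecture.HodgeConjecture.Theorems.NodalThetaWeilWeilClassesPrimitive
import Literature.AlgebraicGeometry.HodgeTheory.WeilCharacterDecomposition
import HarnessLib

/-!
# Crux `NodeDualClassesAlgebraic` (stmt-HodgeConjecture-7745), nodal-boundary line — part 2:
# the CANONICAL certificate, and primitivity made unconditional

Route `HodgeConjecture/NodalThetaWeil`; continuation of
`NodalThetaWeilNodeDualClassesAlgebraicNodalBoundary` (K-rigidity of algebraicity; the crux and the target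
`WeilSixfolds` BY NAME from one Weil-visible threefold class at the nodes of a nodal theta member). That
file's residual asks for a class that is *Weil-visible*: `p(ψ^*) s ∈ W ∖ 0` for SOME test isogeny `ψ` and
SOME polynomial `p`. With the `K`-character decomposition `H⁶ = W ⊕ W'` now proved on the carriers
(`Literature/…/WeilCharacterDecomposition`: `W' = Σ_{a+b=6, a,b ≥ 1} ⋀ᵃ V₊ ⊗ ⋀ᵇ V₋`, the mixed
`K`-eigenclass spaces; `weilVisible_iff_not_mem_nonWeil`), Weil-visibility is the CANONICAL, period-free
test "`s ∉ W'`" = "the component of `s` on the Weil plane is non-zero" (Thomas: "`π_W` is a polynomial in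
the `K`-action"; the certificate `(ψ₀, P₀)` of `exists_weilProjectorPolynomial` is explicit).

## What is proved (no `sorry`, no definition, no named fact)

§1 `weilSixfolds_pointwise_of_algebraic_not_mem_nonWeil` — on an abelian sixfold `(A, φ ≫ φ = -d)`, ONE
algebraic class `s ∈ N³H⁶` with `s ∉ W'` makes every class of the Weil plane algebraic;
`weilSixfolds_pointwise_iff_exists_algebraic_not_mem_nonWeil` — on a BALANCED sixfold this is an
equivalence (HC for the Weil plane `⟺` some algebraic class has a non-zero Weil component).

§2 `weilSixfolds_of_nodalThetaThreefold_not_mem_nonWeil`,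
`nodeDualClassesAlgebraic_of_nodalThetaThreefold_not_mem_nonWeil` — the target (stmt-2524) and the crux
(stmt-7745) BY NAME from the nodal-boundary carrier statement with the canonical certificate: every
balanced Weil sixfold carries an ample `Θ`, `k ≥ 2`, a nodal member `ι : D ↪ A` of `|kΘ|`, and a smooth
projective threefold `h : V ⟶ D` through a node with `(h ≫ ι)_* b ∉ W'` for some `b ∈ H⁰(V(ℂ); ℂ)`
(the class of the threefold has a non-zero Weil component).

§3 `hermitian_cupProduct_weilClass_eq_zero` — **the support item `WeilClassesPrimitive`
(stmt-HodgeConjecture-7746) made UNCONDITIONAL**: its "character decomposition of `H²ⁿ⁺²`" hypothesis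
is `iSup_pullbackEigenclasses_weilCharacter_eq_top`; so on every abelian `2n`-fold `(A, φ ≫ φ = -d)` a
`K`-hermitian degree-`2` class `e` (character `(x + iy√d)(x - iy√d)`; e.g. the class of a
`φ`-symmetric polarization) cups to ZERO against every class of the Weil plane. This is the mechanism
that sends the route to the NODES: a Weil class restricts to `0` in `H⁶` against every hermitian
divisor class, so it is invisible on smooth hermitian theta members (Gysin injective there) and can
only be carried through singular members (Thomas 2005, Thm. 1).

HONEST STATUS. Nothing here is a case of the Hodge conjecture; the crux stays open, now phrased as:
per balanced Weil sixfold, exhibit one threefold (at the nodes of a nodal theta member) whose class in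
`H⁶(A(ℂ); ℂ)` is not in the span of the mixed `K`-eigenclasses.
References: [Thomas2005Nodes] Thm. 1, §3 eq. (d), §4; [vanGeemen1994HodgeAV] 4.9–4.11, Lemma 5.2,
proof of Thm. 6.12; [Deligne1982HodgeCycles] Prop. 4.4; [Schoen1985] Lemma 1.1.
-/

noncomputable section

set_option linter.dupNamespace false

open CategoryTheory AlgebraicGeometry
open Literature.AlgebraicGeometry.Motives Literature.AlgebraicGeometry.HodgeTheory
  Literature.AlgebraicGeometry.Resolution
  Literature.AlgebraicTopology.SingularHomology
open Summit.HodgeConjecture.HodgeConjecture.Theses.NodalThetaWeil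

namespace Summit.HodgeConjecture.HodgeConjecture.Theorems.NodeDualClassesAlgebraic

/-- `nonWeil A φ d` — the span `W'` of the mixed `K`-eigenclass spaces `⋀ᵃ V₊ ⊗ ⋀ᵇ V₋`, `a + b = 6`,
`a, b ≥ 1`, of `H⁶(A(ℂ); ℂ)` (display only; nothing is defined; the literal expression of
`Literature/…/WeilCharacterDecomposition`). -/
local notation3 "nonWeil " A:max φ:max d:max =>
  (⨆ (a : ℕ) (b : ℕ) (_ : a + b = 2 * 3) (_ : 0 < a) (_ : 0 < b),
    pullbackEigenclasses A φ (2 * 3) (fun x y =>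
      ((x : ℂ) + (y : ℂ) * Complex.I * (Real.sqrt d : ℂ)) ^ a *
        ((x : ℂ) - (y : ℂ) * Complex.I * (Real.sqrt d : ℂ)) ^ b))

/-- `IsNodalThetaMember A Θ k ι` — "`ι` is an `m`-nodal (`m ≥ 1`) member of `|kΘ|`" (display only;
the same text as in part 1 and in the 7744 files). -/
local notation3 "IsNodalThetaMember " A:max Θ:max k:max ι:max =>
  (∃ m : ℕ, 1 ≤ m ∧ IsNodalDivisor 5 m ι ∧
    ∃ hI : IsEffectiveCartier (ι).left.ker,
      (CartierDivisor.ofIsEffectiveCartier (ι).left.ker hI).LinEquiv (k • Θ))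

/-! ## §1 One algebraic class with a non-zero Weil component -/

section Canonical

variable {A : AbelianVariety ℂ}

/-- **One algebraic class off the mixed span makes the Weil plane algebraic** (abelian sixfold,
`φ ≫ φ = -d·𝟙`, `d ≥ 1`): `s ∉ W'` is Weil-visibility with the canonical certificate
(`weilVisible_of_not_mem_nonWeil`), and K-rigidity of algebraicity (part 1,
`weilClassesOf_le_algebraicClasses_of_weilVisible`) concludes. [cite: Thomas2005Nodes, §4]
[cite: vanGeemen1994HodgeAV, 4.9 and proof of Thm. 6.12] -/
theorem weilClassesOf_le_algebraicClasses_of_algebraic_not_mem_nonWeil {d : ℕ} (hd : 0 < d)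
    (hdim : A.dim = 2 * 3) {φ : A ⟶ A} (hφ : φ ≫ φ = -(d • 𝟙 A)) {s : complexBetti A.X (2 * 3)}
    (hs : s ∈ algebraicClasses A.X 3) (hsW' : s ∉ nonWeil A φ d) :
    weilClassesOf A φ 3 d ≤ algebraicClasses A.X 3 := by
  obtain ⟨x, y, p, -, htW, ht0⟩ := weilVisible_of_not_mem_nonWeil (n := 3) (by norm_num) hd hφ hsW'
  exact weilClassesOf_le_algebraicClasses_of_weilVisible (by norm_num) hdim hd hφ hs ⟨x, y, p, htW, ht0⟩

/-- **The conclusion of `WeilSixfolds` for ONE sixfold from ONE algebraic class off the mixed span**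
(the route's binder spelling of "`c` in the Weil plane"). [cite: Thomas2005Nodes, §4] [cite: vanGeemen1994HodgeAV, proof of Thm. 6.12] -/
theorem weilSixfolds_pointwise_of_algebraic_not_mem_nonWeil {d : ℕ} (hd : 0 < d)
    (hdim : A.dim = 2 * 3) {φ : A ⟶ A} (hφ : φ ≫ φ = -(d • 𝟙 A))
    (hex : ∃ s ∈ algebraicClasses A.X 3, s ∉ nonWeil A φ d) :
    ∀ c : singularCohomology ℂ ℂ (ComplexPoints A.X) (2 * 3), IsRationalClass c →
      IsOfHodgeType (2 * 3) A.X (2 * 3) 3 3 c →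
      (∃ c₁ c₂ : singularCohomology ℂ ℂ (ComplexPoints A.X) (2 * 3), c = c₁ + c₂ ∧
        (∀ x y : ℕ, singularCohomology.map ℂ ℂ (AlgPoints.mapContinuous (L := ℂ) (x • 𝟙 A + y • φ).hom.hom.hom) (2 * 3) c₁ =
          ((x : ℂ) + (y : ℂ) * Complex.I * (Real.sqrt d : ℂ)) ^ (2 * 3) • c₁) ∧
        (∀ x y : ℕ, singularCohomology.map ℂ ℂ (AlgPoints.mapContinuous (L := ℂ) (x • 𝟙 A + y • φ).hom.hom.hom) (2 * 3) c₂ =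
          ((x : ℂ) - (y : ℂ) * Complex.I * (Real.sqrt d : ℂ)) ^ (2 * 3) • c₂)) →
      c ∈ algebraicClasses A.X 3 := by
  intro c _ _ hw
  obtain ⟨s, hs, hsW'⟩ := hex
  exact weilClassesOf_le_algebraicClasses_of_algebraic_not_mem_nonWeil hd hdim hφ hs hsW'
    (mem_weilClassesOf_iff.mpr hw)

/-- **On a BALANCED Weil sixfold: the Hodge conjecture for the Weil plane `⟺` some algebraic class of
`H⁶` has a non-zero Weil component** (`⟸` §1; `⟹` a non-zero rational Weil class is of type `(3,3)`,
algebraic by hypothesis, and lies off `W'` by `W ⊓ W' = 0`, `weilClassesOf_inf_nonWeil_eq_bot`). The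
residual of the nodal-boundary line in canonical form. [cite: Deligne1982HodgeCycles, Prop. 4.4]
[cite: vanGeemen1994HodgeAV, 4.9–4.10 and proof of Thm. 6.12] [cite: Thomas2005Nodes, §4] -/
theorem weilSixfolds_pointwise_iff_exists_algebraic_not_mem_nonWeil {d : ℕ} (hd : 0 < d)
    (hdim : A.dim = 2 * 3) {φ : A ⟶ A} (hφ : φ ≫ φ = -(d • 𝟙 A))
    (hbal : Module.finrank ℂ ↥(Module.End.eigenspace (complexBetti.map φ.hom.hom.hom 1).hom
          (Complex.I * (Real.sqrt d : ℂ)) ⊓ hodgeOneZero (isSmoothProjective_of_dim_eq' hdim)) = 3) :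
    (∀ c : singularCohomology ℂ ℂ (ComplexPoints A.X) (2 * 3), IsRationalClass c →
      IsOfHodgeType (2 * 3) A.X (2 * 3) 3 3 c →
      (∃ c₁ c₂ : singularCohomology ℂ ℂ (ComplexPoints A.X) (2 * 3), c = c₁ + c₂ ∧
        (∀ x y : ℕ, singularCohomology.map ℂ ℂ (AlgPoints.mapContinuous (L := ℂ) (x • 𝟙 A + y • φ).hom.hom.hom) (2 * 3) c₁ =
          ((x : ℂ) + (y : ℂ) * Complex.I * (Real.sqrt d : ℂ)) ^ (2 * 3) • c₁) ∧
        (∀ x y : ℕ, singularCohomology.map ℂ ℂ (AlgPoints.mapContinuous (L := ℂ) (x • 𝟙 A + y • φ).hom.hom.hom) (2 * 3) c₂ =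
          ((x : ℂ) - (y : ℂ) * Complex.I * (Real.sqrt d : ℂ)) ^ (2 * 3) • c₂)) →
      c ∈ algebraicClasses A.X 3) ↔
    ∃ s ∈ algebraicClasses A.X 3, s ∉ nonWeil A φ d := by
  constructor
  · intro hW
    obtain ⟨c, hcW, hc0, hcr⟩ := exists_isRationalClass_ne_zero_mem_weilClassesOf (n := 3)
      (by norm_num) hdim hd hφ
    have hh : IsOfHodgeType (2 * 3) A.X (2 * 3) 3 3 c :=
      isOfHodgeType_of_mem_weilClassesOf (m := 3) (by norm_num) hdim hd hφ hbal hcW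
    refine ⟨c, hW c hcr hh (mem_weilClassesOf_iff.mp hcW), fun hcW' ↦ hc0 ?_⟩
    exact (Submodule.eq_bot_iff _).mp (weilClassesOf_inf_nonWeil_eq_bot (n := 3) (by norm_num) hd φ)
      c ⟨hcW, hcW'⟩
  · intro hex
    exact weilSixfolds_pointwise_of_algebraic_not_mem_nonWeil hd hdim hφ hex

end Canonical

/-! ## §2 The crux and the target BY NAME, canonical certificate -/

section NodalBoundary

/-- **`WeilSixfolds` (stmt-2524) BY NAME from the nodal-boundary carrier statement with the canonical
certificate**: every balanced Weil sixfold carries an ample `Θ`, `k ≥ 2`, a nodal member `ι : D ↪ A`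
of `|kΘ|`, a smooth projective threefold `h : V ⟶ D` through a node, and `b ∈ H⁰(V(ℂ); ℂ)` such that
the class `(h ≫ ι)_* b` of the threefold is NOT in the mixed span `W'` (its Weil component is
non-zero). As in part 1, only "algebraic + off `W'`" is consumed by the glue; the theta/nodal clauses
locate the cycle. [cite: Thomas2005Nodes, Thm. 1, §3 eq. (d) and §4] [cite: Schoen1985, Lemma 1.1]
[cite: Deligne1982HodgeCycles, Prop. 4.4] -/
theorem weilSixfolds_of_nodalThetaThreefold_not_mem_nonWeil
    (hB : ∀ (d : ℕ), 0 < d → ∀ (A : AbelianVariety ℂ) (φ : A ⟶ A), A.dim = 2 * 3 →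
      ∀ hsp : IsSmoothProjective (2 * 3) A.X, φ ≫ φ = -(d • 𝟙 A) →
      Module.finrank ℂ ↥(Module.End.eigenspace (complexBetti.map φ.hom.hom.hom 1).hom
            (Complex.I * (Real.sqrt d : ℂ)) ⊓ hodgeOneZero hsp) = 3 →
      ∃ (Θ : CartierDivisor A.X.left) (k : ℕ) (D : SchemeOver ℂ) (ι : D ⟶ A.X),
        Θ.IsAmple ∧ 2 ≤ k ∧ IsNodalThetaMember A Θ k ι ∧
        ∃ (V : SchemeOver ℂ) (hV : IsSmoothProjective 3 V) (h : V ⟶ D),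
          (∃ v : V.left, ¬ IsRegularLocalRing (D.left.presheaf.stalk (h.left.base v))) ∧
          ∃ b : complexBetti V 0,
            complexGysin complexOrientationFamily hV hsp (h ≫ ι)
              (show 0 + 2 * (2 * 3) = 2 * 3 + 2 * 3 by norm_num) b ∉ nonWeil A φ d) :
    Summit.HodgeConjecture.HodgeConjecture.Theses.NodalThetaWeil.WeilSixfolds := by
  intro d hd A φ hdim hsp hφ c hr hh hw
  have hcW : c ∈ weilClassesOf A φ 3 d := mem_weilClassesOf_iff.mpr hw
  by_cases hc : c = 0
  · rw [hc]
    exact Submodule.zero_mem _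
  have hbal := finrank_eq_of_mem_weilClassesOf (m := 3) (by norm_num) hdim hd hφ hcW hc hh
  obtain ⟨Θ, k, D, ι, -, -, -, V, hV, h, -, b, hb⟩ := hB d hd A φ hdim hsp hφ hbal
  exact weilSixfolds_pointwise_of_algebraic_not_mem_nonWeil hd hdim hφ
    ⟨_, complexGysin_threefold_mem_algebraicClasses hV hsp (h ≫ ι) b, hb⟩ c hr hh hw

/-- **The crux `NodeDualClassesAlgebraic` (stmt-HodgeConjecture-7745) BY NAME from the same carrier
statement** (the crux is the supported case of the target). Canonical form of the explicit-construction
line: per balanced Weil sixfold, ONE threefold through a node of a nodal theta member whose class in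
`H⁶(A(ℂ); ℂ)` has a non-zero Weil component. [cite: Thomas2005Nodes, Thm. 1, §3 eq. (d) and §4]
[cite: Schoen1985, Lemma 1.1] -/
theorem nodeDualClassesAlgebraic_of_nodalThetaThreefold_not_mem_nonWeil
    (hB : ∀ (d : ℕ), 0 < d → ∀ (A : AbelianVariety ℂ) (φ : A ⟶ A), A.dim = 2 * 3 →
      ∀ hsp : IsSmoothProjective (2 * 3) A.X, φ ≫ φ = -(d • 𝟙 A) →
      Module.finrank ℂ ↥(Module.End.eigenspace (complexBetti.map φ.hom.hom.hom 1).hom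
            (Complex.I * (Real.sqrt d : ℂ)) ⊓ hodgeOneZero hsp) = 3 →
      ∃ (Θ : CartierDivisor A.X.left) (k : ℕ) (D : SchemeOver ℂ) (ι : D ⟶ A.X),
        Θ.IsAmple ∧ 2 ≤ k ∧ IsNodalThetaMember A Θ k ι ∧
        ∃ (V : SchemeOver ℂ) (hV : IsSmoothProjective 3 V) (h : V ⟶ D),
          (∃ v : V.left, ¬ IsRegularLocalRing (D.left.presheaf.stalk (h.left.base v))) ∧
          ∃ b : complexBetti V 0,
            complexGysin complexOrientationFamily hV hsp (h ≫ ι)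
              (show 0 + 2 * (2 * 3) = 2 * 3 + 2 * 3 by norm_num) b ∉ nonWeil A φ d) :
    Summit.HodgeConjecture.HodgeConjecture.Theses.NodalThetaWeil.NodeDualClassesAlgebraic :=
  fun d hd A φ hdim hsp hφ c hr hh hw _ ↦
    weilSixfolds_of_nodalThetaThreefold_not_mem_nonWeil hB d hd A φ hdim hsp hφ c hr hh hw

end NodalBoundary

/-! ## §3 Primitivity, unconditionally: a hermitian class kills the Weil plane -/

section Primitive

variable {A : AbelianVariety ℂ}

/-- **`WeilClassesPrimitive` (stmt-HodgeConjecture-7746) with its decomposition hypothesis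
DISCHARGED.** On a complex abelian `2n`-fold `(A, φ ≫ φ = -d·𝟙)`, `n, d ≥ 1`, every degree-`2` class
`e` of `K`-hermitian character `(x·𝟙 + y·φ)^* e = (x + iy√d)(x - iy√d) e` (e.g. `c₁` of a polarization
with `φ^*θ = dθ`) satisfies `e ∪ w = 0` for every `w` in the Weil plane `E₊ ⊔ E₋`: the landed support
theorem `nodalThetaWeil_weilClassesPrimitive_proof` fed with the character decomposition of `H²ⁿ⁺²`
(`iSup_pullbackEigenclasses_weilCharacter_eq_top`: `H²ⁿ⁺² = Σ_{a+b=2n+2, a,b ≤ 2n} ⋀ᵃ V₊ ⊗ ⋀ᵇ V₋`).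
Consequence for the line: a Weil class is invisible against every hermitian divisor class, hence on
smooth hermitian theta members; it can be carried only through the nodes of singular members.
[cite: vanGeemen1994HodgeAV, 4.9–4.11 and proof of Thm. 6.12] [cite: Thomas2005Nodes, Thm. 1] -/
theorem hermitian_cupProduct_weilClass_eq_zero {d : ℕ} (hd : 0 < d) {n : ℕ} (hn : 1 ≤ n)
    (hdim : A.dim = 2 * n) (hX : IsSmoothProjective (2 * n) A.X) {φ : A ⟶ A}
    (hφ : φ ≫ φ = -(d • 𝟙 A)) {e : complexBetti A.X 2}
    (he : e ∈ pullbackEigenclasses A φ 2 (fun x y =>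
      ((x : ℂ) + (y : ℂ) * Complex.I * (Real.sqrt d : ℂ)) *
        ((x : ℂ) - (y : ℂ) * Complex.I * (Real.sqrt d : ℂ))))
    {c : complexBetti A.X (2 * n)} (hc : c ∈ weilClassesOf A φ n d) :
    cupProduct (R := ℂ) (add_comm 2 (2 * n)) e c = 0 := by
  refine nodalThetaWeil_weilClassesPrimitive_proof d hd n hn A φ hdim hX hφ (fun c' ↦ ?_) e he c hc
  have htop := iSup_pullbackEigenclasses_weilCharacter_eq_top hd hφ (2 * n + 2)
  rw [hdim] at htop
  rw [htop]
  exact Submodule.mem_top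

end Primitive

end Summit.HodgeConjecture.HodgeConjecture.Theorems.NodeDualClassesAlgebraic

end
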